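import Summits.QuantumFields.BalabanUV.T4Continuum.Support.DirichletHoleFilling

/-!
# `BalabanUV.T4Continuum.Support.DirichletBlockRegRateLemmas` — NE2 (node U1a) formalisation swarm, sub-row `T4-U1a.S-NE2-D1-DIRICHLET°`, supplier item
# «Δ1-SKELETON» (file 22): REAL-VARIABLE LEMMAS FOR THE TOWER RATE — the two geometric ratios `r₁ = L^{-1/4}` (far part: `√(Q³/N) ≤ r₁^k` when
# `Q⁶ ≤ N = L^k`) and `r₂ = θ^{(log_64 L)/2}` (near part: `θ^J ≤ θ⁻¹·(r₂²)^k` when `N < 64^{J+1}`), both `< 1` and `r₁ ≥ L⁻¹`, plus the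
# small-level bound `r₁^k ≥ 1/3` when `N < 64` (unit b2b-balaban-t4-ne2-formalise-leaf-08, gen 7, file 22)

HONEST FRAMING.  Elementary real analysis; [folklore]; NE2 (U1a) is NOT proved by this file; spine PROVED 0/9 unchanged; NOT infinite volume,
NOT the mass gap, NOT Clay.  HONEST DEPENDENCY (verbatim): «continuum YM on T⁴ ⇐ BetaPertH ∧ nine spine estimates (0/9 proved); BetaPertH ⇐
(D1) ∧ (D4) ∧ CAP+tail; G-an2-4 gates asym, D1 and NE2/3/4.»

WHAT THIS FILE PROVES (0 sorry).  Data `r1 L`, `r2 θ L`; `r1_pow`, `r1_lt_one`, `inv_le_r1`, `r1_nonneg`, `sqrt_div_le_r1_pow`,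
`third_le_r1_pow`, `r2_nonneg`, `r2_lt_one`, `pow_log_le_r2`, `lt_64_of_small`.

ABSOLUTE RULE (cell, verbatim): «No internally-minted statement may enter as a cited fact. Every hypothesis is either kernel-proved in
this package or a verbatim quotation of a PUBLISHED theorem with page reference. The manuscript(s) under audit are NOT citable for
their own disputed steps — they are the thing under adjudication; programme-internal (2001/route/tribunal) claims are never citable.»
[folklore]; two data definitions; no `def … : Prop` fact.  NOT CLAIMED: anything about lattices; NE2; NE3.
-/

noncomputable section

namespace Summit.QuantumFields.BalabanUV.T4Continuum.DirichletBlockRegRateLemmas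

/-- the far ratio `r₁ = L^{-1/4} = √((√L)⁻¹)`. [folklore] -/
def r1 (L : ℕ) : ℝ := Real.sqrt ((Real.sqrt (L : ℝ))⁻¹)

/-- the near ratio `r₂ = √(θ^{log_64 L})`. [folklore] -/
def r2 (θ : ℝ) (L : ℕ) : ℝ := Real.sqrt (θ ^ (Real.logb 64 (L : ℝ)))

/-- `r₁ ≥ 0`. [folklore] -/
theorem r1_nonneg (L : ℕ) : 0 ≤ r1 L := Real.sqrt_nonneg _

/-- `r₁^k = √((√(L^k))⁻¹)`. [folklore] -/
theorem r1_pow (L k : ℕ) : r1 L ^ k = Real.sqrt ((Real.sqrt ((L : ℝ) ^ k))⁻¹) := by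
  -- `√(a^k) = (√a)^k` for `a ≥ 0` (the tree's `Literature.NumberTheory.Automorphic.real_sqrt_pow`, inlined to keep the import light)
  have hsp : ∀ {a : ℝ}, 0 ≤ a → ∀ j : ℕ, Real.sqrt (a ^ j) = Real.sqrt a ^ j := fun {a} ha j => by
    rw [← Real.sqrt_sq (pow_nonneg (Real.sqrt_nonneg a) j), ← pow_mul, mul_comm, pow_mul, Real.sq_sqrt ha]
  rw [r1, ← hsp (inv_nonneg.mpr (Real.sqrt_nonneg _)), inv_pow, ← hsp (Nat.cast_nonneg L)]

/-- `r₁ < 1` (`L ≥ 2`). [folklore] -/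
theorem r1_lt_one {L : ℕ} (hL : 2 ≤ L) : r1 L < 1 := by
  have hL' : (1 : ℝ) < L := by exact_mod_cast (lt_of_lt_of_le one_lt_two hL)
  have h1 : 1 < Real.sqrt (L : ℝ) := by
    rw [show (1 : ℝ) = Real.sqrt 1 from Real.sqrt_one.symm]
    exact Real.sqrt_lt_sqrt zero_le_one hL'
  rw [r1, Real.sqrt_lt' one_pos, one_pow]
  exact inv_lt_one_of_one_lt₀ h1

/-- `L⁻¹ ≤ r₁` (`L ≥ 1`). [folklore] -/
theorem inv_le_r1 {L : ℕ} (hL : 1 ≤ L) : ((L : ℝ))⁻¹ ≤ r1 L := by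
  have hL' : (1 : ℝ) ≤ L := by exact_mod_cast hL
  have hLpos : (0 : ℝ) < L := by linarith
  have hs : 0 < Real.sqrt (L : ℝ) := Real.sqrt_pos.mpr hLpos
  rw [r1, Real.le_sqrt (inv_nonneg.mpr hLpos.le) (inv_nonneg.mpr hs.le), inv_pow]
  rw [inv_le_inv₀ (pow_pos hLpos 2) hs]
  calc Real.sqrt (L : ℝ) ≤ Real.sqrt ((L : ℝ) ^ 2) := Real.sqrt_le_sqrt (by nlinarith)
    _ = (L : ℝ) := Real.sqrt_sq hLpos.le
    _ ≤ (L : ℝ) ^ 2 := by nlinarith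

/-- **far term**: `Q⁶ ≤ N = L^k`, `Q ≥ 0` ⇒ `√(Q³/N) ≤ r₁^k`. [folklore] -/
theorem sqrt_div_le_r1_pow {L k : ℕ} (hL : 1 ≤ L) {Q : ℝ} (hQ : 0 ≤ Q) (hQN : Q ^ 6 ≤ (L : ℝ) ^ k) :
    Real.sqrt (Q ^ 3 / (L : ℝ) ^ k) ≤ r1 L ^ k := by
  have hL' : (1 : ℝ) ≤ L := by exact_mod_cast hL
  have hN : 0 < (L : ℝ) ^ k := pow_pos (by linarith) k
  rw [r1_pow]
  refine Real.sqrt_le_sqrt ?_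
  have hs0 : 0 < Real.sqrt ((L : ℝ) ^ k) := Real.sqrt_pos.mpr hN
  have hsN : Real.sqrt ((L : ℝ) ^ k) * Real.sqrt ((L : ℝ) ^ k) = (L : ℝ) ^ k := Real.mul_self_sqrt hN.le
  have hQ3 : Q ^ 3 ≤ Real.sqrt ((L : ℝ) ^ k) := by
    rw [Real.le_sqrt (by positivity) hN.le]
    calc (Q ^ 3) ^ 2 = Q ^ 6 := by ring
      _ ≤ (L : ℝ) ^ k := hQN
  rw [div_le_iff₀ hN]
  calc Q ^ 3 ≤ Real.sqrt ((L : ℝ) ^ k) := hQ3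
    _ = (Real.sqrt ((L : ℝ) ^ k))⁻¹ * (L : ℝ) ^ k := by
        rw [eq_inv_mul_iff_mul_eq₀ hs0.ne', hsN]

/-- **small levels**: `N = L^k < 64` ⇒ `1/3 ≤ r₁^k`. [folklore] -/
theorem third_le_r1_pow {L k : ℕ} (hL : 1 ≤ L) (hN : (L : ℝ) ^ k < 64) : (1 : ℝ) / 3 ≤ r1 L ^ k := by
  have hL' : (1 : ℝ) ≤ L := by exact_mod_cast hL
  have hNpos : 0 < (L : ℝ) ^ k := pow_pos (by linarith) k
  rw [r1_pow, Real.le_sqrt (by norm_num) (inv_nonneg.mpr (Real.sqrt_nonneg _))]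
  have hs8 : Real.sqrt ((L : ℝ) ^ k) < 8 := by
    rw [show (8 : ℝ) = Real.sqrt 64 by rw [show (64 : ℝ) = 8 ^ 2 by norm_num, Real.sqrt_sq (by norm_num)]]
    exact Real.sqrt_lt_sqrt hNpos.le hN
  have hs0 : 0 < Real.sqrt ((L : ℝ) ^ k) := Real.sqrt_pos.mpr hNpos
  rw [le_inv_comm₀ (by norm_num) hs0]
  norm_num
  linarith

/-- `r₂ ≥ 0`. [folklore] -/
theorem r2_nonneg (θ : ℝ) (L : ℕ) : 0 ≤ r2 θ L := Real.sqrt_nonneg _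

/-- `r₂ < 1` (`0 < θ < 1`, `L ≥ 2`). [folklore] -/
theorem r2_lt_one {θ : ℝ} (hθ0 : 0 < θ) (hθ1 : θ < 1) {L : ℕ} (hL : 2 ≤ L) : r2 θ L < 1 := by
  have hL' : (1 : ℝ) < L := by exact_mod_cast (lt_of_lt_of_le one_lt_two hL)
  have hs : 0 < Real.logb 64 (L : ℝ) := Real.logb_pos (by norm_num) hL'
  rw [r2, Real.sqrt_lt' one_pos, one_pow]
  exact Real.rpow_lt_one hθ0.le hθ1 hs

/-- **near term**: `N = L^k < 64^{J+1}`, `0 < θ ≤ 1` ⇒ `θ^J ≤ θ⁻¹·(r₂²)^k` (indeed `J ≥ k·log_64 L − 1`). [folklore] -/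
theorem pow_log_le_r2 {θ : ℝ} (hθ0 : 0 < θ) (hθ1 : θ ≤ 1) {L : ℕ} (hL : 1 ≤ L) {k J : ℕ} (hJ : (L : ℝ) ^ k < (64 : ℝ) ^ (J + 1)) :
    θ ^ J ≤ θ⁻¹ * (r2 θ L ^ 2) ^ k := by
  have hL' : (1 : ℝ) ≤ L := by exact_mod_cast hL
  have hLpos : (0 : ℝ) < L := by linarith
  -- `k·log_64 L < J + 1`
  have hlog : (k : ℝ) * Real.logb 64 (L : ℝ) < J + 1 := by
    have h1 : Real.logb 64 ((L : ℝ) ^ k) < Real.logb 64 ((64 : ℝ) ^ (J + 1)) :=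
      Real.logb_lt_logb (by norm_num) (pow_pos hLpos k) hJ
    rw [Real.logb_pow, Real.logb_pow, Real.logb_self_eq_one (by norm_num), mul_one] at h1
    exact_mod_cast h1
  -- `r₂² = θ^{log_64 L}`, `(r₂²)^k = θ^{k log_64 L}`
  have hr2 : r2 θ L ^ 2 = θ ^ (Real.logb 64 (L : ℝ)) := by
    rw [r2, Real.sq_sqrt (Real.rpow_nonneg hθ0.le _)]
  rw [hr2, ← Real.rpow_mul_natCast hθ0.le, ← Real.rpow_neg_one, ← Real.rpow_add hθ0, ← Real.rpow_natCast]
  refine Real.rpow_le_rpow_of_exponent_ge hθ0 hθ1 ?_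
  rw [mul_comm] at hlog
  linarith

/-- **small levels are few**: `L ≥ 2`, `Q⁶ ≤ N = L^k`, `L·N < 64·Q` (with `Q ≥ 1`) ⇒ `N < 64`. [folklore] -/
theorem lt_64_of_small {L N Q : ℕ} (hL : 2 ≤ L) (hQ : Q ^ 6 ≤ N) (hsmall : L * N < 64 * Q) : N < 64 := by
  by_contra h
  push Not at h
  have h1 : N < 32 * Q := by nlinarith
  have h2 : N ^ 6 < (32 * Q) ^ 6 := Nat.pow_lt_pow_left h1 (by norm_num)
  have h3 : (32 * Q) ^ 6 = 2 ^ 30 * Q ^ 6 := by ring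
  have h4 : N ^ 6 < 2 ^ 30 * N := by
    calc N ^ 6 < (32 * Q) ^ 6 := h2
      _ = 2 ^ 30 * Q ^ 6 := h3
      _ ≤ 2 ^ 30 * N := Nat.mul_le_mul_left _ hQ
  have h5 : 64 ^ 5 ≤ N ^ 5 := Nat.pow_le_pow_left h 5
  have hN : 0 < N := by omega
  have h6 : N ^ 5 < 2 ^ 30 := by
    have : N ^ 6 = N ^ 5 * N := by ring
    rw [this] at h4
    exact Nat.lt_of_mul_lt_mul_right (by simpa [mul_comm] using h4)
  have : (64 : ℕ) ^ 5 = 2 ^ 30 := by norm_num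
  omega

end Summit.QuantumFields.BalabanUV.T4Continuum.DirichletBlockRegRateLemmas

end
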